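import Mathlib
import Literature.Analysis.Quadrature.DigitalNets
import Literature.Analysis.Quadrature.OwenScrambling

/-!
# Owen's lemma: joint Walsh moments of two points under the same nested uniform scramble

Let two points `x, x' ∈ [0,1)` with base-`b` digit sequences `ξ = (ξ_1, ξ_2, …)`, `ξ' = (ξ'_1, …)`
be scrambled with the SAME nested uniform scramble `Π` (Owen's scrambling [Dick–Pillichshammer
2010, §13.1]; `scrambleDigits`, `scrambleMeasure` of
`Literature.Analysis.Quadrature.OwenScrambling`), `y = x_Π`, `y' = x'_Π`, and, if `x ≠ x'`,
let `r` be the number of leading digits they share (`ξ_i = ξ'_i` for `i ≤ r`,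
`ξ_{r+1} ≠ ξ'_{r+1}`).  **Owen's lemma** [DP2010, Lemma 13.3, "referred to as Owen's lemma"; Owen
1997] computes the second moments of the `b`-adic Walsh system under this randomisation:
`E[wal_k(y) conj wal_{k'}(y')] = 0` for `k ≠ k'`, and for `k = k'`
`E[wal_k(y ⊖ y')] = 1` if `k < bʳ`, `= -1/(b-1)` if `bʳ ≤ k < b^{r+1}`, `= 0` if `k ≥ b^{r+1}`;
equivalently (second form, p. 404), for `k` with exactly `ℓ` digits (`b^{ℓ-1} ≤ k < b^ℓ`) and ANY
`x, x'`, `E[wal_k(y ⊖ y')] = (b χ[⌊b^ℓ x⌋ = ⌊b^ℓ x'⌋] - χ[⌊b^{ℓ-1} x⌋ = ⌊b^{ℓ-1} x'⌋]) / (b - 1)`,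
so that for a point family `x_0, …, x_{N-1}` with `M_w = #{(n, n') : ⌊b^w x_n⌋ = ⌊b^w x_{n'}⌋}`
one gets `Σ_{n,n'} E[wal_k(y_n ⊖ y_{n'})] = (b M_ℓ - M_{ℓ-1})/(b - 1)` — the factor multiplying
`σ_ℓ²(f)` in the scrambled-net variance formula [DP2010, Cor. 13.4].  The mechanism (proof of
Lemma 13.3, eqs. (13.8)–(13.10)): `η_j = η'_j` for `j ≤ r` (the same permutations act on the same
digits), `(η_{r+1}, η'_{r+1}) = (π_{ξ_1…ξ_r}(ξ_{r+1}), π_{ξ_1…ξ_r}(ξ'_{r+1}))` is a uniformly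
distributed pair of DISTINCT digits, all later digits of `y` and of `y'` are independent and
uniform, and `wal_k` is a product of characters of single digits.

We formalise, on the digit space `ℕ → Fin b` (digit `i` in Lean = digit `i+1` of the book) and for
`b ≥ 2` (`1 < b`; `b` need not be prime here):

* `integral_comp_apply_pair_permMeasure` — under a uniform permutation `p` of `{0, …, b-1}` the
  images `(p(a), p(a'))` of two distinct digits form a uniform pair of distinct digits:
  `∫ φ(p(a), p(a')) dP = (1/(b(b-1))) Σ_{c ≠ c'} φ(c, c')` [DP2010, Lemma 13.3, eq. (13.9)];
* `integral_prod_scrambleMeasure` — independence of the permutations of a nested uniform scramble: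
  `E[∏_{j ∈ J} F_j(π_j)] = ∏_{j ∈ J} E[F_j(π_j)]` over finitely many distinct digit strings `j`;
* `integral_walshD_scrambleDigits_mul_conj_self` — one point: `E[wal_k(ξ_Π) conj wal_{k'}(ξ_Π)] =
  [k = k']` (Prop. 13.1 with the orthonormality of the Walsh system, Prop. A.10);
* `integral_walshD_scrambleDigits_mul_conj` — **Lemma 13.3, first form**, for two digit sequences
  sharing exactly their first `r` digits and all `k, k'`;
  `integral_walshD_scrambleDigits_mul_conj_of_ne` — the case `k ≠ k'` for arbitrary `ξ, ξ'`;
* `integral_walshD_scrambleDigits_mul_conj_eq` — **Lemma 13.3, second form**, for arbitrary `ξ, ξ'`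
  and `b^{ℓ-1} ≤ k < b^ℓ`, the coincidence `⌊b^w x⌋ = ⌊b^w x'⌋` being rendered as equality of the
  length-`w` digit prefixes `digitsPrefix b w`;
* `prefixPairCount` (`M_w`) and `sum_sum_integral_walshD_scrambleDigits_mul_conj` — the summed
  form `Σ_{n,n'} E[wal_k(ξ_{n,Π}) conj wal_k(ξ_{n',Π})] = (b M_ℓ - M_{ℓ-1})/(b - 1)`.

Design.  As in `OwenScrambling`, everything is stated on the digit space, where the scramble acts
(`scrambleDigits`) and where `walshD b k` of `Literature.Analysis.Quadrature.DigitalNets` reads the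
Walsh function off the digits; the book's `wal_k(y ⊖ y')` is `wal_k(y) conj wal_k(y')` [DP2010,
Prop. A.4; `walshD_mul_conj_walshD_eq_prod`].  The transport to `y = x_Π ∈ [0,1)` (`owenScramble`,
`walsh`) would only add the almost-sure identification `Real.digits (Real.ofDigits η) = η` off the
null set of digit sequences eventually equal to `b - 1`, which Mathlib does not provide; the
variance formula downstream consumes exactly the digit-space statements.  The proof follows the
book: the integrand is a finite product, over the DISTINCT permutations `π_{ξ_1…ξ_i}`,
`π_{ξ'_1…ξ'_i}` (`i < R`) met along the two points, of characters of one or two image digits; the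
expectation factorises over the product measure (`Measure.infinitePi_map_restrict`), and the factors
are the character sums `(1/b) Σ_η ω_b^{cη} = [c = 0]` and (13.9)–(13.10).  Small private lemmas on
base-`b` digits and character sums are re-proved here because their counterparts in `DigitalNets`
are private.  Deliberately NOT here: Corollary 13.4 / Theorem 13.5 (the variance
`Var[Î(f)] = N⁻² Σ_ℓ (b M_ℓ - M_{ℓ-1})/(b-1) · σ_ℓ²(f)` and its evaluation for scrambled
`(0, m, 1)`-nets), the multivariate gain coefficients (§13.3.2) and the improved rates for smooth
integrands.

## References

* J. Dick, F. Pillichshammer, *Digital Nets and Sequences. Discrepancy Theory and Quasi–Monte Carlo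
  Integration*, Cambridge University Press 2010, §13.3.1 "The one-dimensional case": Lemma 13.3
  (pp. 402–404; proof, eqs. (13.8)–(13.10); second form and `M_w`, p. 404), Corollary 13.4
  (p. 404). [DickPillichshammer2010, Lemma 13.3]
* A. B. Owen, *Monte Carlo variance of scrambled net quadrature*, SIAM J. Numer. Anal. 34 (1997),
  1884–1910 (the original of "Owen's lemma"; cited through [DP2010, ref. 207]).
* A. B. Owen, *Scrambled net variance for integrals of smooth functions*, Ann. Statist. 25 (1997),
  1541–1562 [DP2010, ref. 208].

AI-produced formalisation (H21 engines group, seat eng-quad-1, 2026-08-21); no facts, no axioms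
beyond Mathlib's, no `sorry`.
-/

open MeasureTheory Complex Finset
open scoped ENNReal ComplexConjugate

noncomputable section

namespace Literature.Analysis.Quadrature

variable (b : ℕ)

/-! ### Integrals against the uniform law on permutations -/

/-- `∫ F dP = (1/b!) Σ_p F(p)` for the uniform law on the `b!` digit permutations. [folklore] -/
private theorem integral_permMeasure (F : Equiv.Perm (Fin b) → ℂ) :
    ∫ p, F p ∂permMeasure b = ((Fintype.card (Equiv.Perm (Fin b)) : ℝ)⁻¹) • ∑ p, F p := by
  rw [permMeasure, integral_smul_measure, integral_count, ENNReal.toReal_inv,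
    ENNReal.toReal_natCast]

/-- A function of ONE image digit: `∫ ψ(p(a)) dP(p) = (1/b) Σ_c ψ(c)` (the image of a fixed digit
under a uniform permutation is a uniform digit). [folklore] -/
private theorem integral_comp_apply_permMeasure [NeZero b] (a : Fin b) (ψ : Fin b → ℂ) :
    ∫ p, ψ (p a) ∂permMeasure b = ((b : ℝ)⁻¹) • ∑ c, ψ c := by
  have h := integral_map (μ := permMeasure b) (φ := fun p : Equiv.Perm (Fin b) => p a)
    (measurable_of_finite _).aemeasurable (f := ψ) (measurable_of_finite ψ).aestronglyMeasurable
  rw [map_apply_permMeasure] at h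
  rw [← h, digitMeasure, integral_smul_measure, integral_count, ENNReal.toReal_inv,
    ENNReal.toReal_natCast]

/-- The permutations sending the distinct digits `a ≠ a'` to the distinct pair `(c, c')` are as many
as those sending them to `(d, d')` (compose with a permutation taking `(c, c')` to `(d, d')`).
[folklore] -/
private theorem card_filter_apply_pair_eq {a a' : Fin b} (c c' d d' : Fin b) (hc : c ≠ c')
    (hd : d ≠ d') :
    (Finset.univ.filter fun p : Equiv.Perm (Fin b) => p a = c ∧ p a' = c').card =
      (Finset.univ.filter fun p : Equiv.Perm (Fin b) => p a = d ∧ p a' = d').card := by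
  -- `τ = swap c'' d' ∘ swap c d` with `c'' = swap c d c'` sends `c ↦ d`, `c' ↦ d'`
  set c'' := Equiv.swap c d c' with hc''
  have hc''d : c'' ≠ d := by
    rw [hc'']
    by_cases h : c' = d
    · rw [h, Equiv.swap_apply_right]; exact fun h' => hc (h'.symm ▸ h.symm ▸ rfl) |>.elim
    · rw [Equiv.swap_apply_of_ne_of_ne (Ne.symm hc) h]; exact h
  set τ : Equiv.Perm (Fin b) := Equiv.swap c'' d' * Equiv.swap c d with hτ
  have hτc : τ c = d := by
    rw [hτ, Equiv.Perm.mul_apply, Equiv.swap_apply_left,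
      Equiv.swap_apply_of_ne_of_ne (Ne.symm hc''d) hd]
  have hτc' : τ c' = d' := by
    rw [hτ, Equiv.Perm.mul_apply, ← hc'', Equiv.swap_apply_left]
  clear_value c'' τ
  refine card_bij' (fun p _ => τ * p) (fun p _ => τ⁻¹ * p) ?_ ?_ ?_ ?_
  · intro p hp
    simp only [Finset.mem_filter, Finset.mem_univ, true_and] at hp ⊢
    exact ⟨by rw [Equiv.Perm.mul_apply, hp.1, hτc], by rw [Equiv.Perm.mul_apply, hp.2, hτc']⟩
  · intro p hp
    simp only [Finset.mem_filter, Finset.mem_univ, true_and] at hp ⊢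
    exact ⟨by rw [Equiv.Perm.mul_apply, hp.1, Equiv.Perm.inv_eq_iff_eq, hτc],
      by rw [Equiv.Perm.mul_apply, hp.2, Equiv.Perm.inv_eq_iff_eq, hτc']⟩
  · intro p _
    rw [← mul_assoc, inv_mul_cancel, one_mul]
  · intro p _
    rw [← mul_assoc, mul_inv_cancel, one_mul]

/-- Hence `b(b-1) · #{p : p(a) = c, p(a') = c'} = b!` for `a ≠ a'`, `c ≠ c'`. [folklore] -/
private theorem card_pairs_mul_card_filter_apply_pair {a a' : Fin b} (ha : a ≠ a') {c c' : Fin b}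
    (hc : c ≠ c') :
    (b * (b - 1)) * (Finset.univ.filter fun p : Equiv.Perm (Fin b) => p a = c ∧ p a' = c').card =
      Fintype.card (Equiv.Perm (Fin b)) := by
  classical
  have hmaps : ∀ p ∈ (univ : Finset (Equiv.Perm (Fin b))),
      (fun p : Equiv.Perm (Fin b) => (p a, p a')) p ∈ (univ : Finset (Fin b)).offDiag :=
    fun p _ => Finset.mem_offDiag.2
      ⟨Finset.mem_univ _, Finset.mem_univ _, fun h => ha (p.injective h)⟩
  have h := card_eq_sum_card_fiberwise hmaps
  rw [card_univ] at h
  rw [h]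
  have hfib : ∀ x ∈ (univ : Finset (Fin b)).offDiag,
      (Finset.univ.filter fun p : Equiv.Perm (Fin b) => (p a, p a') = x).card =
        (Finset.univ.filter fun p : Equiv.Perm (Fin b) => p a = c ∧ p a' = c').card := by
    rintro ⟨d, d'⟩ hx
    have hd : d ≠ d' := (mem_offDiag.1 hx).2.2
    rw [card_filter_apply_pair_eq b (a := a) (a' := a') c c' d d' hc hd]
    congr 1
    ext p
    simp only [Finset.mem_filter, Finset.mem_univ, true_and, Prod.mk.injEq]
  rw [sum_congr rfl hfib, sum_const, smul_eq_mul, offDiag_card, card_univ, Fintype.card_fin,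
    Nat.mul_sub_one]

/-- A function of TWO image digits: for `a ≠ a'`,
`∫ φ(p(a), p(a')) dP(p) = (1/(b(b-1))) Σ_{c ≠ c'} φ(c, c')` — the images of two distinct digits
under a uniform permutation form a uniformly distributed pair of DISTINCT digits.
[cite: DickPillichshammer2010, Lemma 13.3] (proof, eq. (13.9): the factor
`(1/(b(b-1))) Σ_{η_{r+1} ≠ η'_{r+1}}`). -/
theorem integral_comp_apply_pair_permMeasure {a a' : Fin b} (ha : a ≠ a') (φ : Fin b → Fin b → ℂ) :
    ∫ p, φ (p a) (p a') ∂permMeasure b =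
      (((b * (b - 1) : ℕ) : ℝ)⁻¹) • ∑ x ∈ (univ : Finset (Fin b)).offDiag, φ x.1 x.2 := by
  classical
  have hmaps : ∀ p ∈ (univ : Finset (Equiv.Perm (Fin b))),
      (fun p : Equiv.Perm (Fin b) => (p a, p a')) p ∈ (univ : Finset (Fin b)).offDiag :=
    fun p _ => Finset.mem_offDiag.2
      ⟨Finset.mem_univ _, Finset.mem_univ _, fun h => ha (p.injective h)⟩
  rw [integral_permMeasure]
  -- regroup the sum over permutations along the fibres of `p ↦ (p a, p a')`
  have hsum : ∑ p : Equiv.Perm (Fin b), φ (p a) (p a') =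
      ∑ x ∈ (univ : Finset (Fin b)).offDiag,
        ((Finset.univ.filter fun p : Equiv.Perm (Fin b) => (p a, p a') = x).card : ℂ) *
          φ x.1 x.2 := by
    rw [← sum_fiberwise_of_maps_to' hmaps (fun x : Fin b × Fin b => φ x.1 x.2)]
    refine sum_congr rfl fun x _ => ?_
    rw [sum_const, nsmul_eq_mul]
  -- every fibre over a distinct pair has the same size `N` with `b(b-1) N = b!`
  obtain ⟨c, c', hc⟩ : ∃ c c' : Fin b, c ≠ c' := ⟨a, a', ha⟩
  set N := (Finset.univ.filter fun p : Equiv.Perm (Fin b) => p a = c ∧ p a' = c').card with hN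
  have hfib : ∀ x ∈ (univ : Finset (Fin b)).offDiag,
      ((Finset.univ.filter fun p : Equiv.Perm (Fin b) => (p a, p a') = x).card : ℂ) * φ x.1 x.2 =
        (N : ℂ) * φ x.1 x.2 := by
    rintro ⟨d, d'⟩ hx
    have hd : d ≠ d' := (mem_offDiag.1 hx).2.2
    congr 2
    rw [hN, card_filter_apply_pair_eq b (a := a) (a' := a') c c' d d' hc hd]
    congr 1
    ext p
    simp only [Finset.mem_filter, Finset.mem_univ, true_and, Prod.mk.injEq]
  have hcard : (Fintype.card (Equiv.Perm (Fin b)) : ℝ) = ((b * (b - 1) : ℕ) : ℝ) * N := by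
    rw [← card_pairs_mul_card_filter_apply_pair b ha hc]; push_cast; rfl
  have hN0 : (N : ℝ) ≠ 0 := by
    rw [hN, Nat.cast_ne_zero, ← Nat.pos_iff_ne_zero, card_pos]
    refine ⟨Equiv.swap (Equiv.swap a c a') c' * Equiv.swap a c, ?_⟩
    simp only [Finset.mem_filter, Finset.mem_univ, true_and, Equiv.Perm.mul_apply,
      Equiv.swap_apply_left]
    refine ⟨?_, trivial⟩
    have h1 : Equiv.swap a c a' ≠ c := by
      by_cases h : a' = c
      · rw [h, Equiv.swap_apply_right]; exact fun h' => ha (h'.symm ▸ h ▸ rfl) |>.elim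
      · rw [Equiv.swap_apply_of_ne_of_ne (Ne.symm ha) h]; exact h
    exact Equiv.swap_apply_of_ne_of_ne (Ne.symm h1) hc
  rw [hsum, sum_congr rfl hfib, ← mul_sum, hcard, mul_inv, ← smul_smul]
  congr 1
  rw [Complex.real_smul, ← mul_assoc]
  push_cast
  rw [inv_mul_cancel₀ (by exact_mod_cast hN0), one_mul]

/-! ### Base-`b` digits (the helpers of `DigitalNets` are private; re-proved here) -/

/-- Digits are `< b`. [folklore] -/
private theorem natDigit_lt' [NeZero b] (k i : ℕ) : natDigit b k i < b :=
  Nat.mod_lt _ (Nat.pos_of_neZero b)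

/-- All digits of `0` vanish. [folklore] -/
private theorem natDigit_zero' (i : ℕ) : natDigit b 0 i = 0 := by simp [natDigit]

/-- The digits of `k < bⁱ` vanish from position `i` on. [folklore] -/
private theorem natDigit_eq_zero_of_lt' {k i : ℕ} (h : k < b ^ i) : natDigit b k i = 0 := by
  simp [natDigit, Nat.div_eq_of_lt h]

/-- The digits of `k < bⁿ` vanish from position `n` on (`b ≥ 2`). [folklore] -/
private theorem natDigit_eq_zero_of_lt_pow (hb : 1 < b) {k n i : ℕ} (h : k < b ^ n) (hi : n ≤ i) :
    natDigit b k i = 0 :=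
  natDigit_eq_zero_of_lt' b (h.trans_le (Nat.pow_le_pow_right (by omega) hi))

/-- The digits of `k` vanish from position `k` on (`b ≥ 2`). [folklore] -/
private theorem natDigit_eq_zero_of_le' (hb : 1 < b) {k i : ℕ} (h : k ≤ i) : natDigit b k i = 0 :=
  natDigit_eq_zero_of_lt' b (h.trans_lt (Nat.lt_pow_self hb))

/-- If `k ≥ bⁿ` then `k` has a nonzero digit at some position `≥ n` (`b ≥ 2`). [folklore] -/
private theorem exists_natDigit_ne_zero (hb : 1 < b) {k n : ℕ} (h : b ^ n ≤ k) :
    ∃ i, n ≤ i ∧ natDigit b k i ≠ 0 := by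
  have hb0 : 0 < b := by omega
  set m := k / b ^ n with hm
  have hm0 : m ≠ 0 := by rw [hm]; exact (Nat.div_pos h (pow_pos hb0 n)).ne'
  refine ⟨n + Nat.log b m, Nat.le_add_right _ _, ?_⟩
  have h1 : b ^ Nat.log b m ≤ m := Nat.pow_log_le_self b hm0
  have h2 : m < b ^ (Nat.log b m + 1) := Nat.lt_pow_succ_log_self hb m
  have h3 : m / b ^ Nat.log b m < b := by
    rw [Nat.div_lt_iff_lt_mul (pow_pos hb0 _)]
    rwa [pow_succ'] at h2
  rw [natDigit, pow_add, ← Nat.div_div_eq_div_mul, ← hm, Nat.mod_eq_of_lt h3]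
  exact (Nat.div_pos h1 (pow_pos hb0 _)).ne'

/-- The digits `κ_0, …, κ_{R-1}` of `k < bᴿ` are the coordinates of `k` under
`finFunctionFinEquiv : (Fin R → Fin b) ≃ Fin (b ^ R)`. [folklore] -/
private theorem finFunctionFinEquiv_symm_apply_eq_natDigit' {R k : ℕ} (hk : k < b ^ R) (i : Fin R) :
    (finFunctionFinEquiv.symm ⟨k, hk⟩ i : ℕ) = natDigit b k i := by
  simp [natDigit]

/-- Two naturals `< bᴿ` with the same first `R` digits are equal. [folklore] -/
private theorem eq_of_natDigit_eq' {R k l : ℕ} (hk : k < b ^ R) (hl : l < b ^ R)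
    (h : ∀ i < R, natDigit b k i = natDigit b l i) : k = l := by
  have : finFunctionFinEquiv.symm ⟨k, hk⟩ = finFunctionFinEquiv.symm ⟨l, hl⟩ := by
    ext i
    rw [finFunctionFinEquiv_symm_apply_eq_natDigit', finFunctionFinEquiv_symm_apply_eq_natDigit',
      h i i.2]
  simpa using congrArg finFunctionFinEquiv this

/-- Two digits that agree in `ℤ_b` are equal. [folklore] -/
private theorem natDigit_injOn_zmod' [NeZero b] {k l i j : ℕ}
    (h : (natDigit b k i : ZMod b) = natDigit b l j) : natDigit b k i = natDigit b l j := by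
  rw [ZMod.natCast_eq_natCast_iff'] at h
  rwa [Nat.mod_eq_of_lt (natDigit_lt' b k i), Nat.mod_eq_of_lt (natDigit_lt' b l j)] at h

/-- A digit that vanishes in `ℤ_b` vanishes. [folklore] -/
private theorem natDigit_eq_zero_of_cast [NeZero b] {k i : ℕ} (h : (natDigit b k i : ZMod b) = 0) :
    natDigit b k i = 0 := by
  have h' : (natDigit b k i : ZMod b) = natDigit b 0 i := by rw [h, natDigit_zero', Nat.cast_zero]
  rw [natDigit_injOn_zmod' b h', natDigit_zero']

/-! ### Walsh functions as finite products of characters -/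

/-- `wal_k(ξ) = ∏_{i<R} ω_b^{κ_i ξ_{i+1}}` over any digit range containing the digits of `k`.
[folklore] -/
private theorem walshD_eq_prod [NeZero b] {k R : ℕ} (hk : ∀ i, R ≤ i → natDigit b k i = 0)
    (η : ℕ → Fin b) :
    walshD b k η = ∏ i ∈ range R,
      (ZMod.stdAddChar ((natDigit b k i : ZMod b) * ((η i : ℕ) : ZMod b)) : ℂ) := by
  have h := walshD_mul_conj_walshD_eq_prod (b := b) (l := 0) hk (fun i _ => natDigit_zero' b i) η
  rw [walshD_zero, map_one, mul_one] at h
  rw [h]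
  exact prod_congr rfl fun i _ => by rw [natDigit_zero', Nat.cast_zero, sub_zero]

/-- `conj wal_k(ξ) = ∏_{i<R} ω_b^{-κ_i ξ_{i+1}}`. [folklore] -/
private theorem conj_walshD_eq_prod [NeZero b] {k R : ℕ} (hk : ∀ i, R ≤ i → natDigit b k i = 0)
    (η : ℕ → Fin b) :
    conj (walshD b k η) = ∏ i ∈ range R,
      (ZMod.stdAddChar (-((natDigit b k i : ZMod b) * ((η i : ℕ) : ZMod b))) : ℂ) := by
  have h := walshD_mul_conj_walshD_eq_prod (b := b) (k := 0) (fun i _ => natDigit_zero' b i) hk η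
  rw [walshD_zero, one_mul] at h
  rw [h]
  exact prod_congr rfl fun i _ => by rw [natDigit_zero', Nat.cast_zero, zero_sub, neg_mul]

/-! ### Character sums over one and two image digits -/

/-- Reindexing a sum over the digits `Fin b` as a sum over `ℤ_b`. [folklore] -/
private theorem sum_fin_eq_sum_zmod' [NeZero b] {M : Type*} [AddCommMonoid M] (F : ZMod b → M) :
    ∑ a : Fin b, F ((a : ℕ) : ZMod b) = ∑ x : ZMod b, F x := by
  refine Fintype.sum_bijective (fun a : Fin b => ((a : ℕ) : ZMod b)) ?_ _ _ fun _ => rfl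
  refine (Fintype.bijective_iff_injective_and_card _).2 ⟨fun a₁ a₂ h => ?_, by simp⟩
  have h' : (a₁ : ℕ) % b = a₂ % b := (ZMod.natCast_eq_natCast_iff' _ _ _).1 h
  exact Fin.ext (by rwa [Nat.mod_eq_of_lt a₁.2, Nat.mod_eq_of_lt a₂.2] at h')

/-- Orthogonality of characters: `Σ_{a ∈ ℤ_b} ω_b^{c a} = b [c = 0]`. [folklore] -/
private theorem sum_stdAddChar_mul [NeZero b] (c : ZMod b) :
    ∑ a : Fin b, (ZMod.stdAddChar (c * ((a : ℕ) : ZMod b)) : ℂ) = if c = 0 then (b : ℂ) else 0 := by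
  classical
  simp_rw [mul_comm c]
  rw [sum_fin_eq_sum_zmod' b (fun x => (ZMod.stdAddChar (x * c) : ℂ)),
    AddChar.sum_mulShift c (ZMod.isPrimitive_stdAddChar b), ZMod.card]
  split_ifs <;> simp

/-- One image digit: `∫ ω_b^{c p(a)} dP(p) = [c = 0]`. [folklore] -/
private theorem integral_stdAddChar_apply_permMeasure [NeZero b] (a : Fin b) (c : ZMod b) :
    ∫ p, (ZMod.stdAddChar (c * (((p a : Fin b) : ℕ) : ZMod b)) : ℂ) ∂permMeasure b =
      if c = 0 then 1 else 0 := by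
  rw [integral_comp_apply_permMeasure b a (fun x => (ZMod.stdAddChar (c * ((x : ℕ) : ZMod b)) : ℂ)),
    sum_stdAddChar_mul]
  have hb : (b : ℂ) ≠ 0 := Nat.cast_ne_zero.2 (NeZero.ne b)
  split_ifs
  · rw [Complex.real_smul]; push_cast; exact inv_mul_cancel₀ hb
  · rw [smul_zero]

/-- Two image digits of distinct digits `a ≠ a'`:
`∫ ω_b^{c p(a)} ω_b^{-c' p(a')} dP(p) = [c = c'] · (1 if c = 0, -1/(b-1) if c ≠ 0)`.
[cite: DickPillichshammer2010, Lemma 13.3] (proof, eq. (13.10) and the display before it). -/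
private theorem integral_stdAddChar_apply_pair_permMeasure [NeZero b] {a a' : Fin b} (ha : a ≠ a')
    (c c' : ZMod b) :
    ∫ p, (ZMod.stdAddChar (c * (((p a : Fin b) : ℕ) : ZMod b)) : ℂ) *
        ZMod.stdAddChar (-(c' * (((p a' : Fin b) : ℕ) : ZMod b))) ∂permMeasure b =
      if c = c' then (if c = 0 then 1 else -((b : ℂ) - 1)⁻¹) else 0 := by
  classical
  have hb2 : 2 ≤ b := by
    by_contra h
    exact ha (Fin.ext (by have := a.2; have := a'.2; omega))
  rw [integral_comp_apply_pair_permMeasure b ha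
    (fun x y => (ZMod.stdAddChar (c * ((x : ℕ) : ZMod b)) : ℂ) *
      ZMod.stdAddChar (-(c' * ((y : ℕ) : ZMod b))))]
  -- the character sum over the pairs of distinct digits
  have hfull : ∑ x : Fin b, ∑ y : Fin b, (ZMod.stdAddChar (c * ((x : ℕ) : ZMod b)) : ℂ) *
      ZMod.stdAddChar (-(c' * ((y : ℕ) : ZMod b))) =
        (if c = 0 then (b : ℂ) else 0) * (if c' = 0 then (b : ℂ) else 0) := by
    rw [← Finset.sum_mul_sum, sum_stdAddChar_mul]
    simp_rw [← neg_mul]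
    rw [sum_stdAddChar_mul]
    simp only [neg_eq_zero]
  have hdiag : ∑ x : Fin b, (ZMod.stdAddChar (c * ((x : ℕ) : ZMod b)) : ℂ) *
      ZMod.stdAddChar (-(c' * ((x : ℕ) : ZMod b))) = if c = c' then (b : ℂ) else 0 := by
    have : ∀ x : Fin b, (ZMod.stdAddChar (c * ((x : ℕ) : ZMod b)) : ℂ) *
        ZMod.stdAddChar (-(c' * ((x : ℕ) : ZMod b))) =
          ZMod.stdAddChar ((c - c') * ((x : ℕ) : ZMod b)) := fun x => by
      rw [← AddChar.map_add_eq_mul]; congr 1; ring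
    simp_rw [this]
    rw [sum_stdAddChar_mul]
    simp only [sub_eq_zero]
  have hsplit : ∑ x : Fin b, ∑ y : Fin b, (ZMod.stdAddChar (c * ((x : ℕ) : ZMod b)) : ℂ) *
      ZMod.stdAddChar (-(c' * ((y : ℕ) : ZMod b))) =
        (∑ x : Fin b, (ZMod.stdAddChar (c * ((x : ℕ) : ZMod b)) : ℂ) *
          ZMod.stdAddChar (-(c' * ((x : ℕ) : ZMod b)))) +
        ∑ x ∈ (univ : Finset (Fin b)).offDiag, (ZMod.stdAddChar (c * ((x.1 : ℕ) : ZMod b)) : ℂ) *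
          ZMod.stdAddChar (-(c' * ((x.2 : ℕ) : ZMod b))) := by
    rw [← Finset.sum_product' univ univ (fun x y : Fin b =>
      (ZMod.stdAddChar (c * ((x : ℕ) : ZMod b)) : ℂ) *
        ZMod.stdAddChar (-(c' * ((y : ℕ) : ZMod b)))),
      ← Finset.diag_union_offDiag,
      Finset.sum_union (Finset.disjoint_diag_offDiag _), Finset.sum_diag]
  rw [hfull, hdiag] at hsplit
  have hS : ∑ x ∈ (univ : Finset (Fin b)).offDiag,
      (ZMod.stdAddChar (c * ((x.1 : ℕ) : ZMod b)) : ℂ) *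
        ZMod.stdAddChar (-(c' * ((x.2 : ℕ) : ZMod b))) =
        (if c = 0 then (b : ℂ) else 0) * (if c' = 0 then (b : ℂ) else 0) -
          (if c = c' then (b : ℂ) else 0) := by
    rw [hsplit]; ring
  rw [hS, Complex.real_smul]
  have hcast : (((((b * (b - 1) : ℕ) : ℝ)⁻¹ : ℝ) : ℂ)) = ((b : ℂ) * ((b : ℂ) - 1))⁻¹ := by
    push_cast [Nat.cast_sub (show 1 ≤ b by omega)]; ring
  rw [hcast]
  have hb0 : (b : ℂ) ≠ 0 := Nat.cast_ne_zero.2 (by omega)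
  have hb1 : (b : ℂ) - 1 ≠ 0 := by
    rw [sub_ne_zero]; exact_mod_cast (show b ≠ 1 by omega)
  by_cases hc : c = c'
  · subst hc
    by_cases h0 : c = 0
    · simp only [h0, if_true]
      field_simp
    · simp only [h0, if_false, if_true, zero_mul, zero_sub]
      field_simp
  · have h00 : (if c = 0 then (b : ℂ) else 0) * (if c' = 0 then (b : ℂ) else 0) = 0 := by
      by_cases h0 : c = 0
      · have h0' : c' ≠ 0 := fun h => hc (h0.trans h.symm)
        rw [if_neg h0', mul_zero]
      · rw [if_neg h0, zero_mul]
    rw [h00, if_neg hc, if_neg hc, sub_zero, mul_zero]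

/-! ### Independence of the coordinates of the scramble -/

/-- The expectation of a finite product of functions of DISTINCT permutations `π_j`, `j ∈ J`, of a
uniform nested scramble is the product of the expectations (the permutations are independent).
[cite: DickPillichshammer2010, Lemma 13.3] (proof: "the permutations … are all independent from
each other"). -/
theorem integral_prod_scrambleMeasure (J : Finset ((k : ℕ) × (Fin k → Fin b)))
    (F : ((k : ℕ) × (Fin k → Fin b)) → Equiv.Perm (Fin b) → ℂ) :
    ∫ π, ∏ j ∈ J, F j (π j) ∂scrambleMeasure b = ∏ j ∈ J, ∫ p, F j p ∂permMeasure b := by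
  classical
  set G : (↥J → Equiv.Perm (Fin b)) → ℂ := fun g => ∏ j : ↥J, F j (g j) with hG
  have hfun : (fun π : Scramble b => ∏ j ∈ J, F j (π j)) = fun π => G (J.restrict π) := by
    ext π
    simp only [hG, Finset.restrict_def]
    rw [← prod_coe_sort]
  rw [hfun, ← integral_map_of_stronglyMeasurable (Finset.measurable_restrict _)
    (measurable_of_countable G).stronglyMeasurable, scrambleMeasure,
    Measure.infinitePi_map_restrict, hG,
    integral_fintype_prod_eq_prod (fun (j : ↥J) (p : Equiv.Perm (Fin b)) => F j p),
    ← prod_coe_sort J]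

/-! ### Common prefixes of two digit sequences -/

/-- If `ξ`, `ξ'` share exactly their first `r` digits (`ξ_i = ξ'_i` for `i ≤ r`,
`ξ_{r+1} ≠ ξ'_{r+1}`), then their length-`w` prefixes agree iff `w ≤ r`. [folklore] -/
private theorem digitsPrefix_eq_iff_le {ξ ξ' : ℕ → Fin b} {r : ℕ} (hr : ∀ i < r, ξ i = ξ' i)
    (hne : ξ r ≠ ξ' r) (w : ℕ) : digitsPrefix b w ξ = digitsPrefix b w ξ' ↔ w ≤ r := by
  constructor
  · intro h
    by_contra hlt
    exact hne (congrFun h ⟨r, not_le.1 hlt⟩)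
  · intro hw
    funext j
    exact hr j (lt_of_lt_of_le j.2 hw)

/-- Two distinct digit sequences share exactly their first `r` digits for some `r` (the position of
the first difference). [folklore] -/
private theorem exists_first_ne {ξ ξ' : ℕ → Fin b} (h : ξ ≠ ξ') :
    ∃ r, (∀ i < r, ξ i = ξ' i) ∧ ξ r ≠ ξ' r := by
  classical
  have hex : ∃ i, ξ i ≠ ξ' i := by
    by_contra! H
    exact h (funext H)
  exact ⟨Nat.find hex, fun i hi => not_not.1 (Nat.find_min hex hi), Nat.find_spec hex⟩

/-- For a fixed digit sequence, the scrambled digits depend measurably on the scramble.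
[folklore] -/
private theorem measurable_scrambleDigits_left' (ξ : ℕ → Fin b) :
    Measurable fun π : Scramble b => scrambleDigits b π ξ :=
  measurable_pi_lambda _ fun k =>
    (measurable_from_top (f := fun p : Equiv.Perm (Fin b) => p (ξ k))).comp
      (measurable_pi_apply (⟨k, digitsPrefix b k ξ⟩ : (k : ℕ) × (Fin k → Fin b)))

/-- Two Walsh functions of the SAME scrambled point: `E[wal_k(ξ_Π) conj wal_{k'}(ξ_Π)] = [k = k']`,
since `ξ_Π` has i.i.d. uniform digits (Proposition 13.1) and the Walsh system is orthonormal.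
[cite: DickPillichshammer2010, Prop. 13.1] with [cite: DickPillichshammer2010, Prop. A.10]. -/
theorem integral_walshD_scrambleDigits_mul_conj_self [NeZero b] (hb : 1 < b) (ξ : ℕ → Fin b)
    (k k' : ℕ) :
    ∫ π, walshD b k (scrambleDigits b π ξ) * conj (walshD b k' (scrambleDigits b π ξ))
        ∂scrambleMeasure b = if k = k' then 1 else 0 := by
  have hF : Measurable fun η : ℕ → Fin b => walshD b k η * conj (walshD b k' η) :=
    (measurable_walshD k).mul (continuous_conj.measurable.comp (measurable_walshD k'))
  rw [← integral_walshD_mul_conj_walshD hb k k', ← map_scrambleDigits_scrambleMeasure b ξ,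
    integral_map (measurable_scrambleDigits_left' b ξ).aemeasurable hF.aestronglyMeasurable]

/-! ### Owen's lemma (Lemma 13.3) -/

/-- **Owen's lemma** [cite: DickPillichshammer2010, Lemma 13.3] (first form; Owen 1997), on the
digit space: let the digit sequences `ξ = (ξ₁, ξ₂, …)`, `ξ' = (ξ'₁, ξ'₂, …)` of two points share
exactly their first `r` digits (`ξ_i = ξ'_i` for `i ≤ r`, `ξ_{r+1} ≠ ξ'_{r+1}`), and scramble both
with the SAME uniformly distributed nested scramble `Π`. Then
`E[wal_k(ξ_Π) conj wal_{k'}(ξ'_Π)] = 0` for `k ≠ k'`, and for `k = k'` it equals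
`1` if `0 ≤ k < bʳ`, `-1/(b-1)` if `bʳ ≤ k < b^{r+1}`, and `0` if `k ≥ b^{r+1}`. -/
theorem integral_walshD_scrambleDigits_mul_conj [NeZero b] (hb : 1 < b) {ξ ξ' : ℕ → Fin b}
    {r : ℕ} (hr : ∀ i < r, ξ i = ξ' i) (hne : ξ r ≠ ξ' r) (k k' : ℕ) :
    ∫ π, walshD b k (scrambleDigits b π ξ) * conj (walshD b k' (scrambleDigits b π ξ'))
        ∂scrambleMeasure b =
      if k = k' then (if k < b ^ r then 1 else if k < b ^ (r + 1) then -((b : ℂ) - 1)⁻¹ else 0)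
      else 0 := by
  classical
  -- a digit range `[0, R)` containing the digits of `k`, `k'` and the position `r`
  obtain ⟨R, hrR, hkR, hk'R⟩ : ∃ R, r < R ∧ (∀ i, R ≤ i → natDigit b k i = 0) ∧
      (∀ i, R ≤ i → natDigit b k' i = 0) :=
    ⟨max k k' + r + 1, by omega, fun i hi => natDigit_eq_zero_of_le' b hb (by omega),
      fun i hi => natDigit_eq_zero_of_le' b hb (by omega)⟩
  have hkbR : k < b ^ R := by
    by_contra h
    obtain ⟨i, hi, hne0⟩ := exists_natDigit_ne_zero b hb (not_lt.1 h)
    exact hne0 (hkR i hi)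
  have hk'bR : k' < b ^ R := by
    by_contra h
    obtain ⟨i, hi, hne0⟩ := exists_natDigit_ne_zero b hb (not_lt.1 h)
    exact hne0 (hk'R i hi)
  -- the coordinates of the scramble met along `ξ` and `ξ'`
  set idx : ℕ → (k : ℕ) × (Fin k → Fin b) := fun i => ⟨i, digitsPrefix b i ξ⟩ with hidx
  set idx' : ℕ → (k : ℕ) × (Fin k → Fin b) := fun i => ⟨i, digitsPrefix b i ξ'⟩ with hidx'
  have hpre : ∀ i, digitsPrefix b i ξ = digitsPrefix b i ξ' ↔ i ≤ r :=
    digitsPrefix_eq_iff_le b hr hne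
  have hcross : ∀ i i', idx i = idx' i' ↔ i = i' ∧ i ≤ r := by
    intro i i'
    constructor
    · intro h
      have h1 : i = i' := congrArg Sigma.fst h
      subst h1
      exact ⟨rfl, (hpre i).1 (eq_of_heq (Sigma.mk.inj_iff.1 h).2)⟩
    · rintro ⟨rfl, hi⟩
      simp only [hidx, hidx', (hpre i).2 hi]
  have hinj : Set.InjOn idx (range R : Finset ℕ) := fun i _ i' _ h => congrArg Sigma.fst h
  have hinj' : Set.InjOn idx' ((range R).filter fun i => r < i : Finset ℕ) :=
    fun i _ i' _ h => congrArg Sigma.fst h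
  set I : Finset ((k : ℕ) × (Fin k → Fin b)) := (range R).image idx with hI
  set I' : Finset ((k : ℕ) × (Fin k → Fin b)) := (range R).image idx' with hI'
  have hmemI' : ∀ i < R, idx i ∈ I' ↔ i ≤ r := by
    intro i hi
    rw [hI', mem_image]
    constructor
    · rintro ⟨i', -, h⟩
      exact ((hcross i i').1 h.symm).2
    · intro h
      exact ⟨i, mem_range.2 hi, ((hcross i i).2 ⟨rfl, h⟩).symm⟩
  have hmemI : ∀ i < R, idx' i ∈ I ↔ i ≤ r := by
    intro i hi
    rw [hI, mem_image]
    constructor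
    · rintro ⟨i', -, h⟩
      obtain ⟨h1, h2⟩ := (hcross i' i).1 h
      exact h1 ▸ h2
    · intro h
      exact ⟨i, mem_range.2 hi, (hcross i i).2 ⟨rfl, h⟩⟩
  have hsdiff : I' \ I = ((range R).filter fun i => r < i).image idx' := by
    ext j
    simp only [mem_sdiff, hI', mem_image, mem_filter, mem_range]
    constructor
    · rintro ⟨⟨i, hi, rfl⟩, hnot⟩
      refine ⟨i, ⟨hi, ?_⟩, rfl⟩
      by_contra hle
      exact hnot ((hmemI i hi).2 (not_lt.1 hle))
    · rintro ⟨i, ⟨hi, hri⟩, rfl⟩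
      exact ⟨⟨i, hi, rfl⟩, fun h => (not_le.2 hri) ((hmemI i hi).1 h)⟩
  -- the factors
  set κ : ℕ → ZMod b := fun i => (natDigit b k i : ZMod b) with hκ
  set κ' : ℕ → ZMod b := fun i => (natDigit b k' i : ZMod b) with hκ'
  set gA : ((k : ℕ) × (Fin k → Fin b)) → Equiv.Perm (Fin b) → ℂ :=
    fun j p => ZMod.stdAddChar (κ j.1 * (((p (ξ j.1) : Fin b) : ℕ) : ZMod b)) with hgA
  set gB : ((k : ℕ) × (Fin k → Fin b)) → Equiv.Perm (Fin b) → ℂ :=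
    fun j p => ZMod.stdAddChar (-(κ' j.1 * (((p (ξ' j.1) : Fin b) : ℕ) : ZMod b))) with hgB
  set F : ((k : ℕ) × (Fin k → Fin b)) → Equiv.Perm (Fin b) → ℂ :=
    fun j p => (if j ∈ I then gA j p else 1) * (if j ∈ I' then gB j p else 1) with hF
  -- Step 1: the integrand is the product of the `F j (π j)` over `j ∈ I ∪ I'`
  have hint : (fun π : Scramble b =>
      walshD b k (scrambleDigits b π ξ) * conj (walshD b k' (scrambleDigits b π ξ'))) =
        fun π => ∏ j ∈ I ∪ I', F j (π j) := by
    ext π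
    rw [walshD_eq_prod b hkR, conj_walshD_eq_prod b hk'R]
    simp only [hF]
    rw [prod_mul_distrib, prod_ite_mem, prod_ite_mem, union_inter_cancel_left,
      union_inter_cancel_right, hI, hI', prod_image hinj,
      prod_image (fun i _ i' _ h => congrArg Sigma.fst h)]
    simp only [hgA, hgB, hidx, hidx', hκ, hκ', scrambleDigits]
  -- Step 2: independence
  have hE : ∫ π, walshD b k (scrambleDigits b π ξ) * conj (walshD b k' (scrambleDigits b π ξ'))
      ∂scrambleMeasure b = ∏ j ∈ I ∪ I', ∫ p, F j p ∂permMeasure b := by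
    rw [hint]
    exact integral_prod_scrambleMeasure b _ F
  -- Step 3: the one-coordinate expectations
  have hΦlt : ∀ i < r, ∫ p, F (idx i) p ∂permMeasure b = if κ i = κ' i then 1 else 0 := by
    intro i hi
    have hiR : i < R := hi.trans hrR
    have h1 : idx i ∈ I := by rw [hI]; exact mem_image_of_mem _ (mem_range.2 hiR)
    have h2 : idx i ∈ I' := (hmemI' i hiR).2 hi.le
    simp only [hF, if_pos h1, if_pos h2]
    simp only [hgA, hgB, hidx]
    have hξ : ξ' i = ξ i := (hr i hi).symm
    simp only [hξ]
    have : ∀ p : Equiv.Perm (Fin b),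
        (ZMod.stdAddChar (κ i * (((p (ξ i) : Fin b) : ℕ) : ZMod b)) : ℂ) *
          ZMod.stdAddChar (-(κ' i * (((p (ξ i) : Fin b) : ℕ) : ZMod b))) =
          ZMod.stdAddChar ((κ i - κ' i) * (((p (ξ i) : Fin b) : ℕ) : ZMod b)) := fun p => by
      rw [← AddChar.map_add_eq_mul]; congr 1; ring
    simp_rw [this]
    rw [integral_stdAddChar_apply_permMeasure]
    simp only [sub_eq_zero]
  have hΦeq : ∫ p, F (idx r) p ∂permMeasure b =
      if κ r = κ' r then (if κ r = 0 then 1 else -((b : ℂ) - 1)⁻¹) else 0 := by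
    have h1 : idx r ∈ I := by rw [hI]; exact mem_image_of_mem _ (mem_range.2 hrR)
    have h2 : idx r ∈ I' := (hmemI' r hrR).2 le_rfl
    simp only [hF, if_pos h1, if_pos h2]
    simp only [hgA, hgB, hidx]
    exact integral_stdAddChar_apply_pair_permMeasure b hne (κ r) (κ' r)
  have hΦgt : ∀ i, r < i → i < R →
      ∫ p, F (idx i) p ∂permMeasure b = if κ i = 0 then 1 else 0 := by
    intro i hri hiR
    have h1 : idx i ∈ I := by rw [hI]; exact mem_image_of_mem _ (mem_range.2 hiR)
    have h2 : idx i ∉ I' := fun h => (not_le.2 hri) ((hmemI' i hiR).1 h)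
    simp only [hF, if_pos h1, if_neg h2, mul_one]
    simp only [hgA, hidx]
    exact integral_stdAddChar_apply_permMeasure b (ξ i) (κ i)
  have hΦ' : ∀ i, r < i → i < R →
      ∫ p, F (idx' i) p ∂permMeasure b = if κ' i = 0 then 1 else 0 := by
    intro i hri hiR
    have h1 : idx' i ∉ I := fun h => (not_le.2 hri) ((hmemI i hiR).1 h)
    have h2 : idx' i ∈ I' := by rw [hI']; exact mem_image_of_mem _ (mem_range.2 hiR)
    simp only [hF, if_neg h1, if_pos h2, one_mul]
    simp only [hgB, hidx']
    simp_rw [← neg_mul]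
    rw [integral_stdAddChar_apply_permMeasure]
    simp only [neg_eq_zero]
  -- Step 4: assemble
  rw [hE, ← union_sdiff_self_eq_union, prod_union disjoint_sdiff, hsdiff, prod_image hinj', hI,
    prod_image hinj]
  have hrmem : r ∈ range R := mem_range.2 hrR
  by_cases hkk : k = k'
  · subst hkk
    rw [if_pos rfl]
    have hκκ : κ = κ' := rfl
    by_cases hk1 : k < b ^ r
    · -- all digits from position `r` on vanish
      rw [if_pos hk1]
      have hz : ∀ i, r ≤ i → κ i = 0 := fun i hi => by
        simp only [hκ, natDigit_eq_zero_of_lt_pow b hb hk1 hi, Nat.cast_zero]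
      rw [prod_eq_one, prod_eq_one, one_mul]
      · intro i hi
        obtain ⟨hiR, hri⟩ := mem_filter.1 hi
        rw [hΦ' i hri (mem_range.1 hiR), ← hκκ, if_pos (hz i hri.le)]
      · intro i hi
        have hiR := mem_range.1 hi
        rcases lt_trichotomy i r with h | h | h
        · rw [hΦlt i h, if_pos rfl]
        · rw [h, hΦeq, if_pos rfl, if_pos (hz r le_rfl)]
        · rw [hΦgt i h hiR, if_pos (hz i h.le)]
    rw [if_neg hk1]
    by_cases hk2 : k < b ^ (r + 1)
    · -- the leading digit sits at position `r`
      rw [if_pos hk2]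
      have hz : ∀ i, r < i → κ i = 0 := fun i hi => by
        simp only [hκ, natDigit_eq_zero_of_lt_pow b hb hk2 (Nat.succ_le_of_lt hi), Nat.cast_zero]
      have hκr : κ r ≠ 0 := by
        obtain ⟨i, hi, hne0⟩ := exists_natDigit_ne_zero b hb (not_lt.1 hk1)
        have hir : i = r := by
          by_contra h
          exact hne0 (natDigit_eq_zero_of_lt_pow b hb hk2 (by omega))
        subst hir
        intro h
        exact hne0 (natDigit_eq_zero_of_cast b h)
      rw [prod_eq_single_of_mem r hrmem, prod_eq_one, mul_one, hΦeq, if_pos rfl, if_neg hκr]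
      · intro i hi
        obtain ⟨hiR, hri⟩ := mem_filter.1 hi
        rw [hΦ' i hri (mem_range.1 hiR), ← hκκ, if_pos (hz i hri)]
      · intro i hi hir
        have hiR := mem_range.1 hi
        rcases lt_trichotomy i r with h | h | h
        · rw [hΦlt i h, if_pos rfl]
        · exact (hir h).elim
        · rw [hΦgt i h hiR, if_pos (hz i h)]
    · -- a digit above position `r` is nonzero
      rw [if_neg hk2]
      obtain ⟨i, hi, hne0⟩ := exists_natDigit_ne_zero b hb (not_lt.1 hk2)
      have hiR : i < R := by
        by_contra h
        exact hne0 (hkR i (not_lt.1 h))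
      have hκi : κ i ≠ 0 := fun h => hne0 (natDigit_eq_zero_of_cast b h)
      rw [prod_eq_zero (mem_range.2 hiR), zero_mul]
      rw [hΦgt i (by omega) hiR, if_neg hκi]
  · rw [if_neg hkk]
    -- some digit below `R` differs
    obtain ⟨i, hiR, hdiff⟩ : ∃ i < R, natDigit b k i ≠ natDigit b k' i := by
      by_contra! H
      exact hkk (eq_of_natDigit_eq' b hkbR hk'bR H)
    have hκi : κ i ≠ κ' i := fun h => hdiff (natDigit_injOn_zmod' b h)
    rcases lt_trichotomy i r with h | h | h
    · rw [prod_eq_zero (mem_range.2 hiR), zero_mul]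
      rw [hΦlt i h, if_neg hκi]
    · subst h
      rw [prod_eq_zero hrmem, zero_mul]
      rw [hΦeq, if_neg hκi]
    · by_cases h0 : κ i = 0
      · have h0' : κ' i ≠ 0 := fun h' => hκi (h0.trans h'.symm)
        exact mul_eq_zero_of_right _
          (prod_eq_zero (mem_filter.2 ⟨mem_range.2 hiR, h⟩) (by rw [hΦ' i h hiR, if_neg h0']))
      · rw [prod_eq_zero (mem_range.2 hiR), zero_mul]
        rw [hΦgt i h hiR, if_neg h0]

/-- **Owen's lemma, `k ≠ k'`** [cite: DickPillichshammer2010, Lemma 13.3]: for ANY two points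
scrambled by the same uniform nested scramble, `E[wal_k(ξ_Π) conj wal_{k'}(ξ'_Π)] = 0` whenever
`k ≠ k'`. -/
theorem integral_walshD_scrambleDigits_mul_conj_of_ne [NeZero b] (hb : 1 < b) (ξ ξ' : ℕ → Fin b)
    {k k' : ℕ} (hkk : k ≠ k') :
    ∫ π, walshD b k (scrambleDigits b π ξ) * conj (walshD b k' (scrambleDigits b π ξ'))
        ∂scrambleMeasure b = 0 := by
  by_cases h : ξ = ξ'
  · subst h
    rw [integral_walshD_scrambleDigits_mul_conj_self b hb, if_neg hkk]
  · obtain ⟨r, hr, hne⟩ := exists_first_ne b h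
    rw [integral_walshD_scrambleDigits_mul_conj b hb hr hne, if_neg hkk]

/-- **Owen's lemma, second form** [cite: DickPillichshammer2010, Lemma 13.3] (display after the
proof, p. 404): for ANY two points `ξ`, `ξ'` scrambled by the same uniform nested scramble and a
wavenumber `k` with exactly `ℓ ≥ 1` base-`b` digits (`b^{ℓ-1} ≤ k < b^ℓ`),
`E[wal_k(ξ_Π) conj wal_k(ξ'_Π)]
  = (b/(b-1)) χ[⌊b^ℓ x⌋ = ⌊b^ℓ x'⌋] - (1/(b-1)) χ[⌊b^{ℓ-1} x⌋ = ⌊b^{ℓ-1} x'⌋]`,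
the coincidence `⌊b^w x⌋ = ⌊b^w x'⌋` of points of `[0,1)` being read as "the first `w` digits
agree". (The book's `wal_k(y ⊖ y')` is `wal_k(y) conj wal_k(y')`, [cite: DickPillichshammer2010,
Prop. A.4].) -/
theorem integral_walshD_scrambleDigits_mul_conj_eq [NeZero b] (hb : 1 < b) (ξ ξ' : ℕ → Fin b)
    {k ℓ : ℕ} (hk : b ^ (ℓ - 1) ≤ k) (hk' : k < b ^ ℓ) :
    ∫ π, walshD b k (scrambleDigits b π ξ) * conj (walshD b k (scrambleDigits b π ξ'))
        ∂scrambleMeasure b =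
      ((b : ℂ) * (if digitsPrefix b ℓ ξ = digitsPrefix b ℓ ξ' then 1 else 0) -
        (if digitsPrefix b (ℓ - 1) ξ = digitsPrefix b (ℓ - 1) ξ' then 1 else 0)) /
        ((b : ℂ) - 1) := by
  have hb1 : (b : ℂ) - 1 ≠ 0 := by
    rw [sub_ne_zero]; exact_mod_cast (show b ≠ 1 by omega)
  by_cases h : ξ = ξ'
  · subst h
    rw [integral_walshD_scrambleDigits_mul_conj_self b hb, if_pos rfl, if_pos rfl, if_pos rfl]
    field_simp
  obtain ⟨r, hr, hne⟩ := exists_first_ne b h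
  rw [integral_walshD_scrambleDigits_mul_conj b hb hr hne, if_pos rfl]
  simp only [digitsPrefix_eq_iff_le b hr hne]
  have hpow : ∀ {m n : ℕ}, b ^ m < b ^ n ↔ m < n := fun {m n} => Nat.pow_lt_pow_iff_right hb
  by_cases h1 : k < b ^ r
  · have hℓr : ℓ ≤ r := by
      have := hpow.1 (lt_of_le_of_lt hk h1); omega
    rw [if_pos h1, if_pos hℓr, if_pos (by omega : ℓ - 1 ≤ r)]
    field_simp
  rw [if_neg h1]
  by_cases h2 : k < b ^ (r + 1)
  · have hℓ1 : ℓ - 1 ≤ r := by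
      have := hpow.1 (lt_of_le_of_lt hk h2); omega
    have hℓ2 : ¬ ℓ ≤ r := by
      have := hpow.1 (lt_of_le_of_lt (not_lt.1 h1) hk'); omega
    rw [if_pos h2, if_neg hℓ2, if_pos hℓ1, mul_zero, zero_sub, neg_div, one_div]
  · have hℓ2 : ¬ ℓ - 1 ≤ r := by
      have := hpow.1 (lt_of_le_of_lt (not_lt.1 h2) hk'); omega
    rw [if_neg h2, if_neg (by omega : ¬ ℓ ≤ r), if_neg hℓ2]
    simp

/-! ### The summed form: the numbers `M_w` -/

section Family

variable {κ : Type*} [Fintype κ]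

/-- `M_w = #{(n, n') : ⌊b^w x_n⌋ = ⌊b^w x_{n'}⌋}`: the number of ORDERED pairs of points of a finite
family (given by digit sequences) sharing their first `w` base-`b` digits (the diagonal included, so
`M_w ≥ N`). [cite: DickPillichshammer2010, Lemma 13.3] (notation `M_w`, p. 404; by Prop. 13.2 it is
the same for the scrambled points). -/
def prefixPairCount (w : ℕ) (ξ : κ → ℕ → Fin b) : ℕ :=
  (Finset.univ.filter fun p : κ × κ => digitsPrefix b w (ξ p.1) = digitsPrefix b w (ξ p.2)).card

/-- **Owen's lemma, summed over a point family** [cite: DickPillichshammer2010, Lemma 13.3]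
(display defining `M_w`, p. 404): for `b^{ℓ-1} ≤ k < b^ℓ`,
`Σ_{n,n'} E[wal_k(ξ_{n,Π}) conj wal_k(ξ_{n',Π})] = (b M_ℓ - M_{ℓ-1})/(b - 1)`. -/
theorem sum_sum_integral_walshD_scrambleDigits_mul_conj [NeZero b] (hb : 1 < b)
    (ξ : κ → ℕ → Fin b) {k ℓ : ℕ} (hk : b ^ (ℓ - 1) ≤ k) (hk' : k < b ^ ℓ) :
    ∑ n, ∑ n', ∫ π, walshD b k (scrambleDigits b π (ξ n)) *
        conj (walshD b k (scrambleDigits b π (ξ n'))) ∂scrambleMeasure b =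
      ((b : ℂ) * prefixPairCount b ℓ ξ - prefixPairCount b (ℓ - 1) ξ) / ((b : ℂ) - 1) := by
  classical
  simp_rw [integral_walshD_scrambleDigits_mul_conj_eq b hb _ _ hk hk']
  simp_rw [← Finset.sum_div, Finset.sum_sub_distrib, ← Finset.mul_sum]
  congr 1
  simp only [prefixPairCount, Finset.natCast_card_filter]
  rw [Fintype.sum_prod_type' (fun n n' : κ =>
      if digitsPrefix b ℓ (ξ n) = digitsPrefix b ℓ (ξ n') then (1 : ℂ) else 0),
    Fintype.sum_prod_type' (fun n n' : κ =>
      if digitsPrefix b (ℓ - 1) (ξ n) = digitsPrefix b (ℓ - 1) (ξ n') then (1 : ℂ) else 0)]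

end Family

end Literature.Analysis.Quadrature

end
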